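import Summits.AtomisticToContinuum.FouriersLaw.Theorems.ContactStieltjesMeasureStieltjesRepresentationCayleyPencilAlgebra
import Summits.AtomisticToContinuum.FouriersLaw.Theorems.ContactStieltjesMeasureStieltjesRepresentationCayleyPencilHerglotzMeasure

/-!
# From the Cayley moments to the Poisson integral

Support for `stub_stieltjesOfPencil` (line `cayley-pencil`, crux `StieltjesRepresentation` of route
`ContactStieltjesMeasure`), part 4/5.

For a pencil `W` with (R) `hR` and (E) `hE` (see part 1) and Cayley transform `C = 2 W 1 - 1`: the moment sequence `c_k = ⟪C^k g, g⟫` is Toeplitz-PSD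
with `c_0 = ‖g‖²`; the scalar resummation `Σ_k (-q)^k (c_k + c_{k+1}) = (γ+1) ⟪g, W γ g⟫`, `q = (γ-1)/(γ+1)`
(`hasSum_momentSeq`); the Poisson closed form `Σ_k (-q)^k (cos kθ + cos (k+1)θ) = (γ+1) K_γ(θ)`,
`K_γ(θ) = γ (1 + cos θ) / (γ² (1 + cos θ) + (1 - cos θ))` (`hasSum_cos_geometric`); and, by dominated convergence,
`⟪g, W γ g⟫ = ∫ K_γ dρ` for every finite measure `ρ` with the moments `c_k` (`inner_eq_integral_poissonFn`).
-/

noncomputable section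

open scoped BigOperators Real Topology ENNReal RealInnerProductSpace
open Finset MeasureTheory Filter

namespace Summit.AtomisticToContinuum.FouriersLaw.Theorems.ContactStieltjesMeasure.CayleyPencil.Stieltjes

open Summit.AtomisticToContinuum.FouriersLaw.Theorems.ContactStieltjesMeasure.CayleyPencil.Algebra
open Summit.AtomisticToContinuum.FouriersLaw.Theorems.ContactStieltjesMeasure.CayleyPencil.Herglotz

variable {K : Type*} [NormedAddCommGroup K] [InnerProductSpace ℝ K] {W : ℝ → K →L[ℝ] K}

/-! ### The Cayley moment sequence -/

/-- `c_k = ⟪C^k g, g⟫`. [folklore] -/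
def momentSeq (W : ℝ → K →L[ℝ] K) (g : K) (k : ℕ) : ℝ := inner ℝ ((cayley W ^ k) g) g

/-- The Cayley moment sequence is Toeplitz-positive (`toeplitz_nonneg` of part 1). [folklore] -/
theorem toeplitzPSD_momentSeq
    (hE : ∀ γ : ℝ, 0 < γ → ∀ f : K, inner ℝ f (W γ f) = γ * ‖W γ f‖ ^ 2)
    (g : K) :
    ∀ (a : ℕ → ℝ) (M : ℕ), 0 ≤ ∑ m ∈ range M, ∑ n ∈ range M, a m * a n * momentSeq W g (max m n - min m n) :=
  fun a M => toeplitz_nonneg hE g a M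

/-- `c_0 = ‖g‖²`. [folklore] -/
theorem momentSeq_zero (g : K) : momentSeq W g 0 = ‖g‖ ^ 2 := by
  simp [momentSeq]

/-- `|c_k| ≤ ‖g‖²` (Toeplitz positivity of the moments). [folklore] -/
theorem abs_momentSeq_le
    (hE : ∀ γ : ℝ, 0 < γ → ∀ f : K, inner ℝ f (W γ f) = γ * ‖W γ f‖ ^ 2)
    (g : K) (k : ℕ) : |momentSeq W g k| ≤ ‖g‖ ^ 2 := by
  rw [← momentSeq_zero (W := W) g]; exact toeplitzPSD_abs_le (toeplitzPSD_momentSeq hE g) k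

/-- `⟪g, S_n g + C (S_n g)⟫ = Σ_{k<n} (-q)^k (c_k + c_{k+1})`. [folklore] -/
theorem inner_partialSum (g : K) (q : ℝ) (n : ℕ) :
    inner ℝ g (partialSum W q n g + cayley W (partialSum W q n g)) =
      ∑ k ∈ range n, (-q) ^ k * (momentSeq W g k + momentSeq W g (k + 1)) := by
  unfold partialSum momentSeq
  rw [map_sum, inner_add_right, inner_sum, inner_sum, ← Finset.sum_add_distrib]
  refine Finset.sum_congr rfl fun k _ => ?_
  rw [map_smul, real_inner_smul_right, real_inner_smul_right, ← pow_succ_apply,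
    real_inner_comm ((cayley W ^ k) g), real_inner_comm ((cayley W ^ (k + 1)) g)]
  ring

/-- **Scalar resummation**: `Σ_k (-q)^k (c_k + c_{k+1}) = (γ+1) ⟪g, W γ g⟫`, `q = (γ-1)/(γ+1)`. [folklore] -/
theorem hasSum_momentSeq
    (hR : ∀ γ γ' : ℝ, 0 < γ → 0 < γ' → ∀ f : K, W γ f - W γ' f = (γ' - γ) • W γ (W γ' f))
    (hE : ∀ γ : ℝ, 0 < γ → ∀ f : K, inner ℝ f (W γ f) = γ * ‖W γ f‖ ^ 2)
    {γ : ℝ} (hγ : 0 < γ) (g : K) :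
    HasSum (fun k => (-((γ - 1) / (γ + 1))) ^ k * (momentSeq W g k + momentSeq W g (k + 1)))
      ((γ + 1) * inner ℝ g (W γ g)) := by
  set q : ℝ := (γ - 1) / (γ + 1) with hq
  have hq1 : |q| < 1 := abs_ratio_lt_one hγ
  -- summability by comparison with a geometric series
  have hsum : Summable (fun k => (-q) ^ k * (momentSeq W g k + momentSeq W g (k + 1))) := by
    refine Summable.of_norm_bounded (g := fun k => |q| ^ k * (2 * ‖g‖ ^ 2))
      ((summable_geometric_of_lt_one (abs_nonneg q) hq1).mul_right _) (fun k => ?_)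
    rw [Real.norm_eq_abs, abs_mul, abs_pow, abs_neg]
    refine mul_le_mul_of_nonneg_left ?_ (pow_nonneg (abs_nonneg q) k)
    have h1 := abs_momentSeq_le hE g k
    have h2 := abs_momentSeq_le hE g (k + 1)
    calc |momentSeq W g k + momentSeq W g (k + 1)| ≤ |momentSeq W g k| + |momentSeq W g (k + 1)| :=
          abs_add_le _ _
      _ ≤ 2 * ‖g‖ ^ 2 := by linarith
  rw [hsum.hasSum_iff_tendsto_nat]
  -- partial sums = `(γ+1)(⟪g, W γ g⟫ - ⟪g, W γ r_n⟫)`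
  have hpart : ∀ n : ℕ, ∑ k ∈ range n, (-q) ^ k * (momentSeq W g k + momentSeq W g (k + 1)) =
      (γ + 1) * inner ℝ g (W γ g) -
        (γ + 1) * inner ℝ g (W γ ((-q) ^ n • (cayley W ^ n) g)) := by
    intro n
    rw [← inner_partialSum, ← resum hR hγ n g, real_inner_smul_right, map_sub, inner_sub_right, mul_sub]
  simp_rw [hpart]
  have h0 : Tendsto (fun n : ℕ => (γ + 1) * inner ℝ g (W γ ((-q) ^ n • (cayley W ^ n) g))) atTop (𝓝 0) := by
    have h := (tendsto_remainder hE hγ g)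
    have h' : Tendsto (fun n : ℕ => inner ℝ g (W γ ((-q) ^ n • (cayley W ^ n) g))) atTop (𝓝 (inner ℝ g (0:K))) :=
      (continuous_inner.comp (continuous_const.prodMk continuous_id)).continuousAt.tendsto.comp h
    rw [inner_zero_right] at h'
    simpa using h'.const_mul (γ + 1)
  have := (tendsto_const_nhds (x := (γ + 1) * inner ℝ g (W γ g))).sub h0
  rw [sub_zero] at this
  exact this

/-! ### The Poisson-type closed form -/

/-- The integrand `K_γ(θ) = γ (1 + cos θ) / (γ² (1 + cos θ) + (1 - cos θ))` ( `= γ/(γ² + tan²(θ/2))` ). [folklore] -/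
def poissonFn (γ θ : ℝ) : ℝ :=
  γ * (1 + Real.cos θ) / (γ ^ 2 * (1 + Real.cos θ) + (1 - Real.cos θ))

/-- The denominator `γ² (1 + cos θ) + (1 - cos θ)` of `K_γ` is positive for `γ > 0`. [folklore] -/
theorem poissonFn_den_pos {γ : ℝ} (hγ : 0 < γ) (θ : ℝ) :
    0 < γ ^ 2 * (1 + Real.cos θ) + (1 - Real.cos θ) := by
  have h1 : -1 ≤ Real.cos θ := Real.neg_one_le_cos θ
  have h2 : Real.cos θ ≤ 1 := Real.cos_le_one θ
  rcases h1.eq_or_lt with h | h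
  · rw [← h]; norm_num
  · have : 0 < 1 + Real.cos θ := by linarith
    positivity

/-- `0 ≤ K_γ(θ)` for `γ > 0`. [folklore] -/
theorem poissonFn_nonneg {γ : ℝ} (hγ : 0 < γ) (θ : ℝ) : 0 ≤ poissonFn γ θ := by
  unfold poissonFn
  refine div_nonneg (mul_nonneg hγ.le ?_) (poissonFn_den_pos hγ θ).le
  linarith [Real.neg_one_le_cos θ]

/-- `K_γ(θ) ≤ γ⁻¹` for `γ > 0`. [folklore] -/
theorem poissonFn_le {γ : ℝ} (hγ : 0 < γ) (θ : ℝ) : poissonFn γ θ ≤ γ⁻¹ := by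
  unfold poissonFn
  rw [div_le_iff₀ (poissonFn_den_pos hγ θ)]
  have h1 : 0 ≤ 1 + Real.cos θ := by linarith [Real.neg_one_le_cos θ]
  have h2 : 0 ≤ 1 - Real.cos θ := by linarith [Real.cos_le_one θ]
  have e : γ⁻¹ * (γ ^ 2 * (1 + Real.cos θ) + (1 - Real.cos θ)) =
      γ * (1 + Real.cos θ) + γ⁻¹ * (1 - Real.cos θ) := by field_simp
  rw [e]
  have : 0 ≤ γ⁻¹ * (1 - Real.cos θ) := mul_nonneg (inv_nonneg.2 hγ.le) h2
  linarith

/-- `K_γ` is continuous for `γ > 0`. [folklore] -/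
theorem continuous_poissonFn {γ : ℝ} (hγ : 0 < γ) : Continuous (poissonFn γ) := by
  unfold poissonFn
  exact Continuous.div (by fun_prop) (by fun_prop) fun θ => (poissonFn_den_pos hγ θ).ne'

/-- **Poisson resummation**: `Σ_k (-q)^k (cos kθ + cos (k+1)θ) = (γ+1) K_γ(θ)`, `q = (γ-1)/(γ+1)`. [folklore] -/
theorem hasSum_cos_geometric {γ : ℝ} (hγ : 0 < γ) (θ : ℝ) :
    HasSum (fun k : ℕ => (-((γ - 1) / (γ + 1))) ^ k * (Real.cos (k * θ) + Real.cos ((k + 1 : ℕ) * θ)))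
      ((γ + 1) * poissonFn γ θ) := by
  set q : ℝ := (γ - 1) / (γ + 1) with hq
  clear_value q
  have hq1 : |q| < 1 := by rw [hq]; exact abs_ratio_lt_one hγ
  have hγ1 : (γ + 1) ≠ 0 := by linarith
  -- complex geometric series with ratio `z = -q e^{iθ}`
  set e : ℂ := Complex.exp (θ * Complex.I) with he
  set z : ℂ := (-q : ℝ) * e with hz
  have hz1 : ‖z‖ < 1 := by
    rw [hz, norm_mul, Complex.norm_real, he, Complex.norm_exp_ofReal_mul_I, mul_one, Real.norm_eq_abs,
      abs_neg]
    exact hq1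
  have hgeo := hasSum_geometric_of_norm_lt_one hz1
  have hmul : HasSum (fun n : ℕ => (1 + e) * z ^ n) ((1 + e) * (1 - z)⁻¹) := hgeo.mul_left (1 + e)
  have hre := Complex.reCLM.hasSum hmul
  simp only [Complex.reCLM_apply] at hre
  -- identify the terms
  have hterm : ∀ n : ℕ, ((1 + e) * z ^ n).re = (-q) ^ n * (Real.cos (n * θ) + Real.cos ((n + 1 : ℕ) * θ)) := by
    intro n
    have hzn : z ^ n = ((-q) ^ n : ℝ) * Complex.exp ((n * θ : ℝ) * Complex.I) := by
      rw [hz, mul_pow, he, ← Complex.exp_nat_mul]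
      push_cast; ring_nf
    have h2 : (1 + e) * z ^ n = ((-q) ^ n : ℝ) * (Complex.exp ((n * θ : ℝ) * Complex.I) +
        Complex.exp ((((n + 1 : ℕ) : ℝ) * θ : ℝ) * Complex.I)) := by
      rw [hzn, he, mul_add, add_mul, one_mul]
      congr 1
      rw [mul_left_comm, ← Complex.exp_add]
      congr 2
      push_cast; ring
    rw [h2, Complex.re_ofReal_mul, Complex.add_re, Complex.exp_ofReal_mul_I_re, Complex.exp_ofReal_mul_I_re]
  -- identify the sum
  have hval : ((1 + e) * (1 - z)⁻¹).re = (γ + 1) * poissonFn γ θ := by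
    have hden := poissonFn_den_pos hγ θ
    have e_re : e.re = Real.cos θ := by rw [he, Complex.exp_ofReal_mul_I_re]
    have e_im : e.im = Real.sin θ := by rw [he, Complex.exp_ofReal_mul_I_im]
    have d_re : (1 - z).re = 1 + q * Real.cos θ := by
      rw [Complex.sub_re, hz, Complex.re_ofReal_mul, e_re, Complex.one_re]; ring
    have d_im : (1 - z).im = q * Real.sin θ := by
      rw [Complex.sub_im, hz, Complex.im_ofReal_mul, e_im, Complex.one_im]; ring
    have hs2 : Real.sin θ * Real.sin θ = 1 - Real.cos θ ^ 2 := by rw [← sq, Real.sin_sq]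
    have hnormSq : Complex.normSq (1 - z) = 1 + 2 * q * Real.cos θ + q ^ 2 := by
      rw [Complex.normSq_apply, d_re, d_im]
      linear_combination (q ^ 2) * hs2
    have hN : 1 + 2 * q * Real.cos θ + q ^ 2 = 2 * (γ ^ 2 * (1 + Real.cos θ) + (1 - Real.cos θ)) / (γ + 1) ^ 2 := by
      rw [hq]; field_simp; ring
    have hNpos : 0 < 1 + 2 * q * Real.cos θ + q ^ 2 := by rw [hN]; positivity
    rw [Complex.mul_re, Complex.inv_re, Complex.inv_im, Complex.add_re, Complex.add_im, Complex.one_re,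
      Complex.one_im, e_re, e_im, zero_add, d_re, d_im, hnormSq]
    have step : (1 + Real.cos θ) * ((1 + q * Real.cos θ) / (1 + 2 * q * Real.cos θ + q ^ 2)) -
        Real.sin θ * (-(q * Real.sin θ) / (1 + 2 * q * Real.cos θ + q ^ 2)) =
        ((1 + q) * (1 + Real.cos θ)) / (1 + 2 * q * Real.cos θ + q ^ 2) := by
      rw [mul_div_assoc', mul_div_assoc', ← sub_div]
      congr 1
      linear_combination q * hs2
    rw [step, hN]
    unfold poissonFn
    rw [hq]
    field_simp
    ring
  have hfun : (fun n : ℕ => ((1 + e) * z ^ n).re) =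
      fun k : ℕ => (-q) ^ k * (Real.cos (k * θ) + Real.cos ((k + 1 : ℕ) * θ)) := funext hterm
  rw [hfun, hval] at hre
  exact hre


/-! ### Integration of the resummation against the Herglotz measure -/

/-- A bounded continuous real function is integrable against a finite measure on `ℝ`. [folklore] -/
theorem integrable_of_continuous_bounded {ρ : Measure ℝ} [IsFiniteMeasure ρ] {f : ℝ → ℝ}
    (hf : Continuous f) {C : ℝ} (hC : ∀ x, ‖f x‖ ≤ C) : Integrable f ρ :=
  (integrable_const C).mono' hf.aestronglyMeasurable (Eventually.of_forall hC)

/-- `⟪g, W γ g⟫ = ∫ K_γ dρ` for any finite measure `ρ` with the Cayley moments. [folklore] -/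
theorem inner_eq_integral_poissonFn
    (hR : ∀ γ γ' : ℝ, 0 < γ → 0 < γ' → ∀ f : K, W γ f - W γ' f = (γ' - γ) • W γ (W γ' f))
    (hE : ∀ γ : ℝ, 0 < γ → ∀ f : K, inner ℝ f (W γ f) = γ * ‖W γ f‖ ^ 2)
    {γ : ℝ} (hγ : 0 < γ) (g : K)
    {ρ : Measure ℝ} [IsFiniteMeasure ρ] (hmom : ∀ k : ℕ, ∫ θ, Real.cos (k * θ) ∂ρ = momentSeq W g k) :
    inner ℝ g (W γ g) = ∫ θ, poissonFn γ θ ∂ρ := by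
  set q : ℝ := (γ - 1) / (γ + 1) with hq
  have hq1 : |q| < 1 := abs_ratio_lt_one hγ
  have hq1' : 0 < 1 - |q| := by linarith
  -- partial sums of the Poisson resummation
  set P : ℕ → ℝ → ℝ := fun n θ =>
    ∑ k ∈ range n, (-q) ^ k * (Real.cos (k * θ) + Real.cos ((k + 1 : ℕ) * θ)) with hP
  have hPcont : ∀ n, Continuous (P n) := fun n => by rw [hP]; fun_prop
  have hPbound : ∀ n θ, ‖P n θ‖ ≤ 2 / (1 - |q|) := by
    intro n θ
    rw [Real.norm_eq_abs, hP]
    calc |∑ k ∈ range n, (-q) ^ k * (Real.cos (k * θ) + Real.cos ((k + 1 : ℕ) * θ))|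
        ≤ ∑ k ∈ range n, |(-q) ^ k * (Real.cos (k * θ) + Real.cos ((k + 1 : ℕ) * θ))| :=
          Finset.abs_sum_le_sum_abs _ _
      _ ≤ ∑ k ∈ range n, |q| ^ k * 2 := by
          refine Finset.sum_le_sum fun k _ => ?_
          rw [abs_mul, abs_pow, abs_neg]
          refine mul_le_mul_of_nonneg_left ?_ (pow_nonneg (abs_nonneg q) k)
          have h1 := Real.abs_cos_le_one (k * θ)
          have h2 := Real.abs_cos_le_one ((k + 1 : ℕ) * θ)
          calc |Real.cos (k * θ) + Real.cos ((k + 1 : ℕ) * θ)|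
              ≤ |Real.cos (k * θ)| + |Real.cos ((k + 1 : ℕ) * θ)| := abs_add_le _ _
            _ ≤ 2 := by linarith
      _ = (∑ k ∈ range n, |q| ^ k) * 2 := by rw [Finset.sum_mul]
      _ ≤ (1 - |q|)⁻¹ * 2 := by
          refine mul_le_mul_of_nonneg_right ?_ (by norm_num)
          have := geom_sum_Ico_le_of_lt_one (abs_nonneg q) hq1 (m := 0) (n := n)
          rw [pow_zero, ← Finset.range_eq_Ico] at this
          simpa [div_eq_inv_mul] using this
      _ = 2 / (1 - |q|) := by rw [div_eq_inv_mul]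
  have hPint : ∀ n, ∫ θ, P n θ ∂ρ = ∑ k ∈ range n, (-q) ^ k * (momentSeq W g k + momentSeq W g (k + 1)) := by
    intro n
    rw [hP]
    simp only
    rw [integral_finsetSum _ (fun k _ => ?_)]
    · refine Finset.sum_congr rfl fun k _ => ?_
      rw [integral_const_mul, integral_add, hmom k, hmom (k + 1)]
      · exact integrable_of_continuous_bounded (by fun_prop) (C := 1)
          (fun x => by simpa using Real.abs_cos_le_one _)
      · exact integrable_of_continuous_bounded (by fun_prop) (C := 1)
          (fun x => by simpa using Real.abs_cos_le_one _)
    · refine (Integrable.add ?_ ?_).const_mul _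
      · exact integrable_of_continuous_bounded (by fun_prop) (C := 1)
          (fun x => by simpa using Real.abs_cos_le_one _)
      · exact integrable_of_continuous_bounded (by fun_prop) (C := 1)
          (fun x => by simpa using Real.abs_cos_le_one _)
  have hPlim : ∀ θ, Tendsto (fun n => P n θ) atTop (𝓝 ((γ + 1) * poissonFn γ θ)) := fun θ => by
    rw [hP]; exact (hasSum_cos_geometric hγ θ).tendsto_sum_nat
  have hDCT : Tendsto (fun n => ∫ θ, P n θ ∂ρ) atTop (𝓝 (∫ θ, (γ + 1) * poissonFn γ θ ∂ρ)) :=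
    tendsto_integral_of_dominated_convergence (fun _ => 2 / (1 - |q|))
      (fun n => (hPcont n).aestronglyMeasurable) (integrable_const _)
      (fun n => Eventually.of_forall (hPbound n)) (Eventually.of_forall hPlim)
  have hser : Tendsto (fun n => ∫ θ, P n θ ∂ρ) atTop (𝓝 ((γ + 1) * inner ℝ g (W γ g))) := by
    simp_rw [hPint]
    exact (hasSum_momentSeq hR hE hγ g).tendsto_sum_nat
  have huniq := tendsto_nhds_unique hser hDCT
  rw [integral_const_mul] at huniq
  have hγ1 : (γ + 1) ≠ 0 := by linarith
  exact mul_left_cancel₀ hγ1 huniq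

/-! ### Registered sub-goal of `stub_stieltjesOfPencil` closed by this file -/

/-- **Sub-goal `stub_stieltjesOfPencil_poissonIntegral`** (part 4/5 of `stub_stieltjesOfPencil`, line `cayley-pencil`):
under (R) and (E), `⟪g, W γ g⟫ = ∫ K_γ dρ` for every finite measure `ρ` whose cosine moments are the Cayley moments
`⟪C^k g, g⟫`, `K_γ(θ) = γ (1 + cos θ) / (γ² (1 + cos θ) + (1 - cos θ))` (`inner_eq_integral_poissonFn` with the
Cayley transform and the kernel spelled out). [folklore] -/
theorem stub_stieltjesOfPencil_poissonIntegral :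
    ∀ (K : Type) [NormedAddCommGroup K] [InnerProductSpace ℝ K] (W : ℝ → K →L[ℝ] K),
      (∀ γ γ' : ℝ, 0 < γ → 0 < γ' → ∀ f : K, W γ f - W γ' f = (γ' - γ) • W γ (W γ' f)) →
      (∀ γ : ℝ, 0 < γ → ∀ f : K, inner ℝ f (W γ f) = γ * ‖W γ f‖ ^ 2) →
      ∀ γ : ℝ, 0 < γ → ∀ (g : K) (ρ : MeasureTheory.Measure ℝ), MeasureTheory.IsFiniteMeasure ρ →
        (∀ k : ℕ, ∫ θ, Real.cos (k * θ) ∂ρ = inner ℝ ((((2 : ℝ) • W 1 - ContinuousLinearMap.id ℝ K) ^ k) g) g) →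
        inner ℝ g (W γ g) = ∫ θ, γ * (1 + Real.cos θ) / (γ ^ 2 * (1 + Real.cos θ) + (1 - Real.cos θ)) ∂ρ := by
  intro K _ _ W hR hE γ hγ g ρ hρ hmom
  haveI := hρ
  exact inner_eq_integral_poissonFn hR hE hγ g hmom

end Summit.AtomisticToContinuum.FouriersLaw.Theorems.ContactStieltjesMeasure.CayleyPencil.Stieltjes

end
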